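import Literature.Probability.RandomPlanarGeometry.SLEProofs
import HarnessLib

/-!
# Measurability of the compactified image along a measurably parametrised family of maps

Parametrised forms of `Literature.Probability.RandomPlanarGeometry.measurable_compactifiedClass`
(`SLEProofs.lean`): if `Ψ : 𝒳 → ℂ → ℂ` is jointly measurable and the endpoint `β : 𝒳 → ℂ` and
the path `w : 𝒳 → (ℝ≥0 → ℂ)` are measurable, then `x ↦ compactifiedClass (Ψ x) (β x) (w x)` is
measurable (`measurable_compactifiedClass₃`); in particular
`(x, w) ↦ compactifiedClass (Ψ x) b w` is measurable on `𝒳 × (ℝ≥0 → ℂ)` (product σ-algebra on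
the path factor, Borel σ-algebra of the curve-class metric on the target;
`measurable_compactifiedClass₂`). The proof is the one of `measurable_compactifiedClass` with
parameters: the node values `x ↦ nodeValue (Ψ x) (β x) (w x) s` (`= Ψ x (w x (s/(1-s)))` for
`s < 1`, `= β x` at `s = 1`) are measurable, the Bernstein approximants `compactifiedApprox` are
continuous functions of finitely many node values, their `limUnder` is strongly measurable
(Mathlib `MeasureTheory.StronglyMeasurable.limUnder`), and `f ↦ CurveClass.mk ⟨f⟩` is
continuous. This is the measurability needed to push a Markov kernel of SLE traces through the
(past-dependent) uniformizing map in the domain Markov property (Lawler (2005), §6.3), and to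
express the class of a stopped past curve measurably in the configuration.

## References

* G. F. Lawler, *Conformally Invariant Processes in the Plane*, AMS (2005), §6.1, §6.3.
-/

noncomputable section

open Set Filter Topology MeasureTheory
open scoped NNReal unitInterval

namespace Literature.Probability.RandomPlanarGeometry

section VaryingEndpoint

variable {𝒳 : Type*} [MeasurableSpace 𝒳] {Ψ : 𝒳 → ℂ → ℂ} {β : 𝒳 → ℂ} {w : 𝒳 → (ℝ≥0 → ℂ)}

/-- Node values are measurable in the parameter, for jointly measurable `Ψ`, measurable endpoint
`β` and measurable path `w`. [folklore] -/
theorem measurable_nodeValue₃ (hΨ : Measurable (Function.uncurry Ψ)) (hβ : Measurable β)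
    (hw : Measurable w) (s : I) :
    Measurable fun x : 𝒳 ↦ nodeValue (Ψ x) (β x) (w x) s := by
  unfold nodeValue
  split_ifs
  · exact hΨ.comp (measurable_id.prodMk ((measurable_pi_apply _).comp hw))
  · exact hβ

/-- The Bernstein approximants of the compactified image are strongly measurable in the
parameter: a continuous map of finitely many measurable node values. [folklore] -/
theorem stronglyMeasurable_compactifiedApprox₃ (hΨ : Measurable (Function.uncurry Ψ))
    (hβ : Measurable β) (hw : Measurable w) (n : ℕ) :
    StronglyMeasurable fun x : 𝒳 ↦ compactifiedApprox (Ψ x) (β x) (w x) n := by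
  have hc : Continuous fun d : Fin (n + 1) → ℂ ↦ ∑ k : Fin (n + 1), d k • bernsteinC n k :=
    continuous_finsetSum _ fun k _ ↦ (continuous_apply k).smul continuous_const
  have hm : Measurable fun (x : 𝒳) (k : Fin (n + 1)) ↦
      nodeValue (Ψ x) (β x) (w x) (bernstein.z k) :=
    measurable_pi_lambda _ fun k ↦ measurable_nodeValue₃ hΨ hβ hw _
  exact hc.stronglyMeasurable.comp_measurable hm

/-- The compactified limit curve is strongly measurable in the parameter
(Mathlib `MeasureTheory.StronglyMeasurable.limUnder`). [folklore] -/
theorem stronglyMeasurable_compactifiedLimit₃ (hΨ : Measurable (Function.uncurry Ψ))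
    (hβ : Measurable β) (hw : Measurable w) :
    StronglyMeasurable fun x : 𝒳 ↦ compactifiedLimit (Ψ x) (β x) (w x) :=
  MeasureTheory.StronglyMeasurable.limUnder (l := atTop)
    (f := fun n (x : 𝒳) ↦ compactifiedApprox (Ψ x) (β x) (w x) n)
    (stronglyMeasurable_compactifiedApprox₃ hΨ hβ hw)

/-- **Measurability of the compactification functional with measurably varying map, endpoint and
path**: for jointly Borel measurable `Ψ : 𝒳 × ℂ → ℂ`, measurable `β : 𝒳 → ℂ` and measurable
`w : 𝒳 → (ℝ≥0 → ℂ)` (product σ-algebra), `x ↦ compactifiedClass (Ψ x) (β x) (w x)` is measurable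
into `CurveClass ℂ` (Borel σ-algebra of the curve-class metric). Used to write the class of a
stopped past curve `u ↦ Φ (γ (r u))` as `compactifiedClass Φ (Φ (γ r)) (t ↦ γ (r t/(1+t)))`
measurably in the configuration (Lawler (2005), §6.3, domain Markov property of chordal SLE in a
domain). [cite: Lawler2005, §6.1] -/
theorem measurable_compactifiedClass₃ {𝒳 : Type*} [MeasurableSpace 𝒳] {Ψ : 𝒳 → ℂ → ℂ}
    (hΨ : Measurable (Function.uncurry Ψ)) {β : 𝒳 → ℂ} (hβ : Measurable β)
    {w : 𝒳 → (ℝ≥0 → ℂ)} (hw : Measurable w) :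
    Measurable fun x : 𝒳 ↦ compactifiedClass (Ψ x) (β x) (w x) :=
  ((CurveClass.continuous_mk.comp continuous_curveMk).comp_stronglyMeasurable
    (stronglyMeasurable_compactifiedLimit₃ hΨ hβ hw)).measurable

end VaryingEndpoint

/-- **Measurability of the compactification functional along a measurable family of maps**: for
jointly Borel measurable `Ψ : 𝒳 × ℂ → ℂ`, the map `(x, w) ↦ compactifiedClass (Ψ x) b w` is
measurable from `𝒳 × (ℝ≥0 → ℂ)` (product σ-algebra) to `CurveClass ℂ` (Borel σ-algebra of the
curve-class metric). Parametrised version of `measurable_compactifiedClass`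
(`measurable_compactifiedClass₃` on `𝒳 × (ℝ≥0 → ℂ)` with constant endpoint); used to push the
law of a fresh SLE trace through a past-dependent conformal map (Lawler (2005), §6.3, domain
Markov property of chordal SLE in a domain). [cite: Lawler2005, §6.1] -/
theorem measurable_compactifiedClass₂ {𝒳 : Type*} [MeasurableSpace 𝒳] {Ψ : 𝒳 → ℂ → ℂ}
    (hΨ : Measurable (Function.uncurry Ψ)) (b : ℂ) :
    Measurable fun p : 𝒳 × (ℝ≥0 → ℂ) ↦ compactifiedClass (Ψ p.1) b p.2 :=
  measurable_compactifiedClass₃ (𝒳 := 𝒳 × (ℝ≥0 → ℂ)) (Ψ := fun p ↦ Ψ p.1)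
    (hΨ.comp (measurable_fst.fst.prodMk measurable_snd)) measurable_const measurable_snd

end Literature.Probability.RandomPlanarGeometry
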